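import Summits.BirchSwinnertonDyer.BirchSwinnertonDyer.Theorems.Rank2ObservatoryPadicAtlasKitR3
import HarnessLib

/-!
# Rank-2 observatory — `p`-adic atlas kit, PACKED symbol tables (one natural number per table)

HONEST FRAMING: per-curve certified theorems and census instruments; no claim on BSD in rank ≥ 2.

The kernel tests `AtlasCell.check` / `AtlasCell.check3` read a plus-symbol table `tab : List ℤ` by
`tab.getD u 0`: `O(u)` reductions per read, and — the dominant cost for the largest two-engine cells,
`p^{n+1} ∈ {1331, 2197, 2401, 3125}` — the ELABORATION of a list literal of `p^{n+1}` numerals (a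
`2197`-entry literal exceeds `3·10⁶` heartbeats). This file lets a cell carry each table PACKED into
ONE natural number `P = Σ_u (tab[u] + o)·2^{w u}` (width `w`, offset `o`): the entry is read by the
kernel's native big-number arithmetic, `readP P w o u = (P / 2^{w u}) % 2^w − o`, and the `List ℤ` table
of the `AtlasCell` is the COMPUTED list `unpack P w o (p^{n+1}) 0` — so every statement of the series
(`AtlasCell.check3`, `AtlasCurve3.padicRow`, the `htab` hypotheses `… = tabHi.getD u 0 / D`) keeps its
meaning verbatim, with `tabHi.getD u 0 = readP P w o u` (`getD_unpack`).

* `readP`, `unpack`, `getD_unpack`;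
* `isumP` (the double sum of `isumL` with packed reads) and `isumP_eq_isumL_hi/lo` (`r = 2`: `certL`,
  `r = 3`: `certL3`);
* `PackedCell` (`p, a_p, n, A, w, o, PHi, PLo, H, L`) with `toCell : AtlasCell`, the Boolean tests
  `validP r`, `checkP` (`r = 2`), `check3P` (`r = 3`) and `check_of_checkP`, `check3_of_check3P`;
* `AtlasCurveP` / `AtlasCurve3P` (census row, bound `B`, packed cells) with `toA` / `toA3`, `checkP`,
  `check_of_checkP` and the per-curve transfer `ok_of_okP : (C.checkP && b) = true → (C.toA….check && b) = true`,
  so that an atlas part defines `c<label> := c<label>p.toA3`, proves `c<label>_ok` from ONE kernel `decide`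
  of the packed test, and is otherwise the shape of the existing parts (same consequence theorems).

No new hypotheses, no change of any statement about symbols; no new axioms, no `sorry`.

References: B. Mazur, J. Tate, J. Teitelbaum, Invent. Math. 84 (1986), §I.10–I.13 (the Riemann sums);
W. Stein, C. Wuthrich, Math. Comp. 82 (2013), §3.
-/

-- single-conjunct summit: `Summit.BirchSwinnertonDyer.BirchSwinnertonDyer.…` repeats the name by design
set_option linter.dupNamespace false

namespace Summit.BirchSwinnertonDyer.BirchSwinnertonDyer.Rank2Observatory

open Literature.NumberTheory.EllipticCurves Literature.NumberTheory.EllipticCurves.ModularForms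
  WeierstrassCurve
open Literature.NumberTheory.Sieve.GoldbachLinnik (primeB prime_of_primeB)

/-! ### Packed tables -/

/-- Entry `i` of a table packed in base `2^w` with offset `o`: `(P / 2^{w i}) % 2^w − o` (native
big-number arithmetic in the kernel). [folklore] -/
def readP (P w o i : ℕ) : ℤ :=
  ((P / 2 ^ (w * i) % 2 ^ w : ℕ) : ℤ) - (o : ℤ)

/-- The list of `fuel` consecutive entries of a packed table starting at index `j` (structural
recursion on the fuel). [folklore] -/
def unpack (P w o : ℕ) : ℕ → ℕ → List ℤ
  | 0, _ => []
  | fuel + 1, j => readP P w o j :: unpack P w o fuel (j + 1)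

/-- **Reading the unpacked list IS reading the packed table**: entry `i < fuel` of
`unpack P w o fuel j` is `readP P w o (j + i)`. [folklore] -/
theorem getD_unpack (P w o : ℕ) :
    ∀ (fuel j i : ℕ), i < fuel → (unpack P w o fuel j).getD i 0 = readP P w o (j + i)
  | 0, _, _, h => absurd h (Nat.not_lt_zero _)
  | _ + 1, j, 0, _ => by rw [unpack, List.getD_cons_zero, Nat.add_zero]
  | fuel + 1, j, i + 1, h => by
    rw [unpack, List.getD_cons_succ, getD_unpack P w o fuel (j + 1) i (by omega), Nat.add_assoc,
      Nat.add_comm 1 i]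

/-! ### The double sums with packed reads -/

section Sums

variable (p : ℕ) [Fact p.Prime]

/-- The integer double sum of `isumL`, reading a PACKED table (the index taken modulo `period`;
`period = 0`: no reduction). [cite: MazurTateTeitelbaum1986Invent, §I.10–I.13] -/
def isumP (n : ℕ) (P w o : ℕ) (period k : ℕ) : ℤ :=
  ∑ y ∈ teichSet p (n + 1), ∑ s : ZMod (p ^ n),
    readP P w o ((y * ((1 + p : ℕ) : ZMod (p ^ (n + 1))) ^ s.val).val % period) * (s.val.choose k : ℤ)

/-- `isumP` (no period) IS `isumL` of the unpacked table of length `p^{n+1}`. [folklore] -/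
theorem isumP_eq_isumL (n P w o k : ℕ) :
    isumP p n P w o 0 k = isumL p n (unpack P w o (p ^ (n + 1)) 0) k := by
  haveI : NeZero (p ^ (n + 1)) := ⟨pow_ne_zero _ (Fact.out : p.Prime).ne_zero⟩
  unfold isumP isumL
  refine Finset.sum_congr rfl fun y _ => Finset.sum_congr rfl fun s _ => ?_
  rw [Nat.mod_zero, getD_unpack P w o _ 0 _ (ZMod.val_lt _), Nat.zero_add]

end Sums

/-! ### Packed cells -/

/-- A two-engine cell with PACKED plus-symbol tables: prime `p`, trace `a_p`, level `n`, unit-root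
digits `A`, packing width `w` and offset `o`, the packed tables `PHi` (length `p^{n+1}`) and `PLo`
(length `p^n`), the double sums `H`, `L`. [cite: MazurTateTeitelbaum1986Invent, §I.10–I.13] -/
structure PackedCell where
  /-- the good ordinary prime `p ≥ 5` -/
  p : ℕ
  /-- the Frobenius trace `a_p` -/
  ap : ℤ
  /-- the level -/
  n : ℕ
  /-- an integer congruent to the unit root modulo `p^n` -/
  A : ℤ
  /-- packing width (bits per entry) -/
  w : ℕ
  /-- packing offset (added to every entry) -/
  o : ℕ
  /-- the packed table of numerators of `D·[u/p^{n+1}]⁺`, `u < p^{n+1}` -/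
  PHi : ℕ
  /-- the packed table of numerators of `D·[v/p^n]⁺`, `v < p^n` -/
  PLo : ℕ
  /-- the integer double sum `ΣHi` -/
  H : ℤ
  /-- the integer double sum `ΣLo` -/
  L : ℤ

namespace PackedCell

variable (c : PackedCell)

/-- The `AtlasCell` of a packed cell: the tables are the unpacked lists. [folklore] -/
def toCell : AtlasCell :=
  ⟨c.p, c.ap, c.n, c.A, unpack c.PHi c.w c.o (c.p ^ (c.n + 1)) 0, unpack c.PLo c.w c.o (c.p ^ c.n) 0,
    c.H, c.L⟩

/-- `isumP` of the level-`p^n` table (period `p^n`) IS `isumL` of the expanded table of `certL`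
(`r = 2`). [folklore] -/
theorem isumP_lo_eq_isumL_certL [Fact c.p.Prime] (k : ℕ) :
    isumP c.p c.n c.PLo c.w c.o (c.p ^ c.n) k = isumL c.p c.n c.toCell.certL.tabLo k := by
  haveI : NeZero (c.p ^ (c.n + 1)) := ⟨pow_ne_zero _ (Fact.out : c.p.Prime).ne_zero⟩
  have hpos : 0 < c.p ^ c.n := pow_pos (Fact.out : c.p.Prime).pos _
  unfold isumP isumL
  refine Finset.sum_congr rfl fun y _ => Finset.sum_congr rfl fun s _ => ?_
  have hval : ((y * ((1 + c.p : ℕ) : ZMod (c.p ^ (c.n + 1))) ^ s.val).val < c.p ^ (c.n + 1)) :=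
    ZMod.val_lt _
  rw [c.toCell.certL_tabLo_getD hval]
  show _ = (unpack c.PLo c.w c.o (c.p ^ c.n) 0).getD
      (((y * ((1 + c.p : ℕ) : ZMod (c.p ^ (c.n + 1))) ^ s.val).val) % c.p ^ c.n) 0 * _
  rw [getD_unpack _ _ _ _ 0 _ (Nat.mod_lt _ hpos), Nat.zero_add]

/-- The same for the `r = 3` certificate `certL3`. [folklore] -/
theorem isumP_lo_eq_isumL_certL3 [Fact c.p.Prime] (k : ℕ) :
    isumP c.p c.n c.PLo c.w c.o (c.p ^ c.n) k = isumL c.p c.n c.toCell.certL3.tabLo k := by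
  haveI : NeZero (c.p ^ (c.n + 1)) := ⟨pow_ne_zero _ (Fact.out : c.p.Prime).ne_zero⟩
  have hpos : 0 < c.p ^ c.n := pow_pos (Fact.out : c.p.Prime).pos _
  unfold isumP isumL
  refine Finset.sum_congr rfl fun y _ => Finset.sum_congr rfl fun s _ => ?_
  have hval : ((y * ((1 + c.p : ℕ) : ZMod (c.p ^ (c.n + 1))) ^ s.val).val < c.p ^ (c.n + 1)) :=
    ZMod.val_lt _
  rw [c.toCell.certL3_tabLo_getD hval]
  show _ = (unpack c.PLo c.w c.o (c.p ^ c.n) 0).getD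
      (((y * ((1 + c.p : ℕ) : ZMod (c.p ^ (c.n + 1))) ^ s.val).val) % c.p ^ c.n) 0 * _
  rw [getD_unpack _ _ _ _ 0 _ (Nat.mod_lt _ hpos), Nat.zero_add]

/-- **The PACKED validity test of a cell with order `r`**: the conjunction of `SymbolCertL.validL`
(`p ≠ 2`, `p ∤ r!`, `p^n ∣ A² − a_p A + p`, `p ∤ A`, `p^n ∤ A·H − L`, `#teichSet = τ`, unit classes,
`ΣHi = H`, `ΣLo = L`) with the sums read from the packed tables.
[cite: MazurTateTeitelbaum1986Invent, §I.10–I.13] -/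
def validP (r : ℕ) [Fact c.p.Prime] : Bool :=
  decide (c.p ≠ 2 ∧ ¬ c.p ∣ r.factorial ∧ (c.p : ℤ) ^ c.n ∣ c.A ^ 2 - c.ap * c.A + c.p ∧
    ¬ (c.p : ℤ) ∣ c.A ∧ ¬ (c.p : ℤ) ^ c.n ∣ c.A * c.H - c.L ∧
    (teichSet c.p (c.n + 1)).card = torsionOrder c.p ∧
    (∀ y ∈ teichSet c.p (c.n + 1), ∀ s : ZMod (c.p ^ c.n),
      ¬ c.p ∣ (y * ((1 + c.p : ℕ) : ZMod (c.p ^ (c.n + 1))) ^ s.val).val) ∧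
    isumP c.p c.n c.PHi c.w c.o 0 r = c.H ∧ isumP c.p c.n c.PLo c.w c.o (c.p ^ c.n) r = c.L)

variable {c}

/-- **Packed test ⟹ `validL` of the `r = 2` certificate of the unpacked cell.** [folklore] -/
theorem validL_certL_of_validP [Fact c.p.Prime] (h : c.validP 2 = true) :
    c.toCell.certL.validL c.p c.ap = true := by
  simp only [validP, decide_eq_true_eq] at h
  obtain ⟨h1, h2, h3, h4, h5, h6, h7, h8, h9⟩ := h
  rw [isumP_eq_isumL] at h8
  rw [isumP_lo_eq_isumL_certL] at h9
  simp only [SymbolCertL.validL, decide_eq_true_eq]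
  exact ⟨h1, h2, h3, h4, h5, h6, h7, h8, h9⟩

/-- **Packed test ⟹ `validL` of the `r = 3` certificate of the unpacked cell.** [folklore] -/
theorem validL_certL3_of_validP [Fact c.p.Prime] (h : c.validP 3 = true) :
    c.toCell.certL3.validL c.p c.ap = true := by
  simp only [validP, decide_eq_true_eq] at h
  obtain ⟨h1, h2, h3, h4, h5, h6, h7, h8, h9⟩ := h
  rw [isumP_eq_isumL] at h8
  rw [isumP_lo_eq_isumL_certL3] at h9
  simp only [SymbolCertL.validL, decide_eq_true_eq]
  exact ⟨h1, h2, h3, h4, h5, h6, h7, h8, h9⟩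

variable (c)

/-- **The PACKED kernel test of a cell, `r = 2`** (the conjuncts of `AtlasCell.check`, validity by
`validP 2`). [folklore] -/
def checkP (e : WeierstrassCurve ℤ) : Bool :=
  decide (5 ≤ c.p) && decide (¬ ((c.p : ℤ) ∣ e.Δ)) && decide ((c.toCell.count e : ℤ) = c.p + 1 - c.ap) &&
    decide (¬ ((c.p : ℤ) ∣ c.ap)) &&
    if hp : primeB c.p = true then @validP c 2 ⟨prime_of_primeB hp⟩ else false

/-- **The PACKED kernel test of a cell, `r = 3`** (the conjuncts of `AtlasCell.check3`, validity by
`validP 3`). [folklore] -/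
def check3P (e : WeierstrassCurve ℤ) : Bool :=
  decide (5 ≤ c.p) && decide (¬ ((c.p : ℤ) ∣ e.Δ)) && decide ((c.toCell.count e : ℤ) = c.p + 1 - c.ap) &&
    decide (¬ ((c.p : ℤ) ∣ c.ap)) &&
    if hp : primeB c.p = true then @validP c 3 ⟨prime_of_primeB hp⟩ else false

variable {c} {e : WeierstrassCurve ℤ}

/-- Packed test ⟹ test of the unpacked cell, `r = 2`. [folklore] -/
theorem check_of_checkP (h : c.checkP e = true) : c.toCell.check e = true := by
  unfold checkP at h
  unfold AtlasCell.check
  simp only [Bool.and_eq_true] at h ⊢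
  obtain ⟨⟨⟨⟨h1, h2⟩, h3⟩, h4⟩, h5⟩ := h
  refine ⟨⟨⟨⟨h1, h2⟩, h3⟩, h4⟩, ?_⟩
  by_cases hp : primeB c.p = true
  · have hp' : primeB c.toCell.p = true := hp
    rw [dif_pos hp] at h5
    rw [dif_pos hp']
    exact @validL_certL_of_validP c ⟨prime_of_primeB hp⟩ h5
  · rw [dif_neg hp] at h5
    exact absurd h5 Bool.false_ne_true

/-- Packed test ⟹ test of the unpacked cell, `r = 3`. [folklore] -/
theorem check3_of_check3P (h : c.check3P e = true) : c.toCell.check3 e = true := by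
  unfold check3P at h
  unfold AtlasCell.check3
  simp only [Bool.and_eq_true] at h ⊢
  obtain ⟨⟨⟨⟨h1, h2⟩, h3⟩, h4⟩, h5⟩ := h
  refine ⟨⟨⟨⟨h1, h2⟩, h3⟩, h4⟩, ?_⟩
  by_cases hp : primeB c.p = true
  · have hp' : primeB c.toCell.p = true := hp
    rw [dif_pos hp] at h5
    rw [dif_pos hp']
    exact @validL_certL3_of_validP c ⟨prime_of_primeB hp⟩ h5
  · rw [dif_neg hp] at h5
    exact absurd h5 Bool.false_ne_true

end PackedCell

/-! ### Curves with packed cells -/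

/-- A rank-2 atlas curve with PACKED cells: census row, minimality bound, packed cells. [folklore] -/
structure AtlasCurveP where
  /-- the census row (`Rank2ObservatoryRank2Rows*.lean`, verbatim) -/
  row : Rank2Row
  /-- minimality bound `B` -/
  B : ℕ
  /-- the packed two-engine cells -/
  cells : List PackedCell

namespace AtlasCurveP

variable (C : AtlasCurveP)

/-- The `AtlasCurve` of a packed curve (cells unpacked). [folklore] -/
def toA : AtlasCurve := ⟨C.row, C.B, C.cells.map PackedCell.toCell⟩

/-- **The PACKED kernel test of a rank-2 curve**: `Δ ≠ 0` and every packed cell passes `checkP`.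
[folklore] -/
def checkP : Bool :=
  decide (C.toA.e.Δ ≠ 0) && C.cells.all fun c => c.checkP C.toA.e

variable {C}

/-- Packed test ⟹ test (rank-2 curve). [folklore] -/
theorem check_of_checkP (h : C.checkP = true) : C.toA.check = true := by
  simp only [checkP, AtlasCurve.check, Bool.and_eq_true, List.all_eq_true] at h ⊢
  refine ⟨h.1, fun c hc => ?_⟩
  obtain ⟨pc, hpc, rfl⟩ := List.mem_map.mp hc
  exact PackedCell.check_of_checkP (h.2 pc hpc)

/-- Per-curve certificate transfer: `(C.checkP && b) = true → (C.toA.check && b) = true`. [folklore] -/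
theorem ok_of_okP {b : Bool} (h : (C.checkP && b) = true) : (C.toA.check && b) = true := by
  simp only [Bool.and_eq_true] at h ⊢
  exact ⟨check_of_checkP h.1, h.2⟩

end AtlasCurveP

/-- A rank-3 atlas curve with PACKED cells: census row, minimality bound, packed cells. [folklore] -/
structure AtlasCurve3P where
  /-- the census row (`Rank2ObservatoryRank3Rows*.lean`, verbatim) -/
  row : Rank3Row
  /-- minimality bound `B` -/
  B : ℕ
  /-- the packed certified cells -/
  cells : List PackedCell

namespace AtlasCurve3P

variable (C : AtlasCurve3P)

/-- The `AtlasCurve3` of a packed curve (cells unpacked). [folklore] -/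
def toA3 : AtlasCurve3 := ⟨C.row, C.B, C.cells.map PackedCell.toCell⟩

/-- **The PACKED kernel test of a rank-3 curve**: `Δ ≠ 0` and every packed cell passes `check3P`.
[folklore] -/
def checkP : Bool :=
  decide (C.toA3.e.Δ ≠ 0) && C.cells.all fun c => c.check3P C.toA3.e

variable {C}

/-- Packed test ⟹ test (rank-3 curve). [folklore] -/
theorem check_of_checkP (h : C.checkP = true) : C.toA3.check = true := by
  simp only [checkP, AtlasCurve3.check, Bool.and_eq_true, List.all_eq_true] at h ⊢
  refine ⟨h.1, fun c hc => ?_⟩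
  obtain ⟨pc, hpc, rfl⟩ := List.mem_map.mp hc
  exact PackedCell.check3_of_check3P (h.2 pc hpc)

/-- Per-curve certificate transfer: `(C.checkP && b) = true → (C.toA3.check && b) = true`. [folklore] -/
theorem ok_of_okP {b : Bool} (h : (C.checkP && b) = true) : (C.toA3.check && b) = true := by
  simp only [Bool.and_eq_true] at h ⊢
  exact ⟨check_of_checkP h.1, h.2⟩

end AtlasCurve3P

end Summit.BirchSwinnertonDyer.BirchSwinnertonDyer.Rank2Observatory
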